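import Literature.NumberTheory.Automorphic.AshSmithTheoryHecke
import Literature.NumberTheory.Automorphic.GLnAdelicStructureProofs
import Literature.NumberTheory.Automorphic.StrongApproximationGL2
import HarnessLib

/-!
# Ash (2003), *Smith theory and Hecke operators* — proofs towards the named fact
# `Ash2003_inducedRayClassCharacter_attached`: the level `K_f(M)` is compact open, so the
# Hecke operators `T_{l,k}` of the fact are genuine finite double-coset sums

Topic `NumberTheory/Automorphic`; companion of `Literature.NumberTheory.Automorphic.AshSmithTheoryHecke`
(the named fact `Ash2003_inducedRayClassCharacter_attached` = A. Ash, *Smith theory and Hecke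
operators*, J. Algebra **259** (2003) 43–58 [Ash2003], Thm. 1.1 / Cor. 4.4).  The fact is typed
with the tree's double-coset Hecke operators `ArithmeticQuotient.heckeFun`,
`(T_g f)(xL) = ∑_{hL ⊆ LgL} f(x h L)`, which carry the documented junk value `0` when `L g L / L` is
infinite.  This file removes that caveat for the level of the fact: for every `M ≥ 1` and every
`g ∈ GL_n(𝔸_ℚ^∞)` the double coset `K_f(M) g K_f(M) / K_f(M)` is finite
(`Ash2003.finite_doubleCosetQuot_finiteLevel`), because `K_f(M)` is a compact open subgroup of
`GL_n(𝔸_ℚ^∞)` (`Ash2003.isCompact_finiteLevel`, `Ash2003.isOpen_finiteLevel`), hence a Hecke pair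
with it (the tree's `isHeckeTriple_top_of_isCompact_isOpen`, `finite_orbit_quotient` of
`HeckeAlgebra`: `K ∩ gKg⁻¹` is open in the compact group `K`, so of finite index; Shimura,
*Introduction to the arithmetic theory of automorphic functions*, Ch. 3, Prop. 3.1).  So the
operators `Ash2003.heckeT` in `Ash2003.IsEigenclass` are the honest finite sums of [Ash2003, §2]
("`K_l s_l K_l = ∐ s_{i,l} K_l` (finite union)", p. 47) — `Ash2003.heckeFun_finiteLevel_apply`.

Everything is proved for a general number field `K` and a nonzero level `𝔫 ⊆ 𝓞 K`: the finite
part `K_f(𝔫) = ofFinite⁻¹ K(𝔫)` of the tree's principal congruence subgroup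
`principalCongruenceLevel n K 𝔫` (`GLnAdelicStructure`) is open
(`isOpen_comap_ofFinite_principalCongruenceLevel`: it contains the open subgroup
`GL_n(𝒪̂_K) ∩ ⋂_{v ∣ 𝔫} {h | h_v ∈ K_v(|𝔫|_v)}`, a finite intersection — the valued congruence
subgroups `K_v(c) ≤ GL_n(K_v)`, `c ≠ 0`, are open, `isOpen_valuedCongruenceSubgroup_of_ne_zero`,
since closed balls of nonzero radius in `K_v` are open, `isOpen_setOf_valued_le` of
`StrongApproximationGL2`) and compact
(`isCompact_comap_ofFinite_principalCongruenceLevel`: an open, hence closed, subgroup of the compact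
`GL_n(𝒪̂_K)`, `isCompact_glFiniteIntegralLevel_holds` of `GLnAdelicStructureProofs`).

## References

* A. Ash, *Smith theory and Hecke operators*, J. Algebra 259 (2003) 43–58, §2 [Ash2003].
* G. Shimura, *Introduction to the arithmetic theory of automorphic functions* (1971), Ch. 3 §3.1,
  Prop. 3.1 [ShimuraIATAF1971].
* D. Bump, *Automorphic forms and representations* (1997), §3.3 (`K_0 = ∏ GL(n, 𝔬_v)` and its
  congruence subgroups are compact open in `GL(n, A_f)`) [Bump1997].
-/

noncomputable section

open scoped NumberField Valued
open IsDedekindDomain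

namespace Literature.NumberTheory.Automorphic

/-! ### Valued congruence subgroups are open -/

section Local

variable (K : Type) [Field K] [NumberField K] (v : HeightOneSpectrum (𝓞 K))

/-- **The valued congruence subgroups `K_v(c) ≤ GL_n(K_v)` (`valuedCongruenceSubgroup`) are open**
for `c ≠ 0`: each of the finitely many defining conditions `|g_{ij}|_v ≤ 1`, `|(g⁻¹)_{ij}|_v ≤ 1`,
`|(g - 1)_{ij}|_v ≤ c` is the preimage of a closed ball of nonzero radius — open,
`isOpen_setOf_valued_le` of `StrongApproximationGL2` — under a continuous map (entries of `g`, of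
`g⁻¹`).  For `c = 1` this is the openness of `GL_n(𝒪_v)` (Bump, §3.3).  (Same statement as
`isOpen_valuedCongruenceSubgroup` of `GLnCuspidalSpectrumProofs`, re-derived in a few lines to keep
this structural file free of that file's `L²`/measure-theoretic imports.) [folklore] -/
theorem isOpen_valuedCongruenceSubgroup_of_ne_zero (n : ℕ) {c : WithZero (Multiplicative ℤ)}
    (hc : c ≠ 0) :
    IsOpen (valuedCongruenceSubgroup (F := v.adicCompletion K) (Fin n) c :
      Set (GL (Fin n) (v.adicCompletion K))) := by
  have h1 : IsOpen {y : v.adicCompletion K | Valued.v y ≤ 1} := isOpen_setOf_valued_le v one_ne_zero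
  have hc' : IsOpen {y : v.adicCompletion K | Valued.v y ≤ c} := isOpen_setOf_valued_le v hc
  have hval : Continuous fun g : GL (Fin n) (v.adicCompletion K) =>
      (g : Matrix (Fin n) (Fin n) (v.adicCompletion K)) := Units.continuous_val
  have hinv : Continuous fun g : GL (Fin n) (v.adicCompletion K) =>
      ((g⁻¹ : GL (Fin n) (v.adicCompletion K)) : Matrix (Fin n) (Fin n) (v.adicCompletion K)) :=
    Units.continuous_coe_inv
  have e1 : ∀ i j : Fin n, IsOpen {g : GL (Fin n) (v.adicCompletion K) |
      Valued.v ((g : Matrix (Fin n) (Fin n) (v.adicCompletion K)) i j) ≤ 1} := fun i j =>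
    h1.preimage (hval.matrix_elem i j)
  have e2 : ∀ i j : Fin n, IsOpen {g : GL (Fin n) (v.adicCompletion K) |
      Valued.v (((g⁻¹ : GL (Fin n) (v.adicCompletion K)) :
        Matrix (Fin n) (Fin n) (v.adicCompletion K)) i j) ≤ 1} := fun i j =>
    h1.preimage (hinv.matrix_elem i j)
  have e3 : ∀ i j : Fin n, IsOpen {g : GL (Fin n) (v.adicCompletion K) |
      Valued.v (((g : Matrix (Fin n) (Fin n) (v.adicCompletion K)) - 1) i j) ≤ c} := fun i j =>
    hc'.preimage ((hval.sub continuous_const).matrix_elem i j)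
  have hset : (valuedCongruenceSubgroup (F := v.adicCompletion K) (Fin n) c :
      Set (GL (Fin n) (v.adicCompletion K))) =
      ((⋂ i, ⋂ j, {g : GL (Fin n) (v.adicCompletion K) |
          Valued.v ((g : Matrix (Fin n) (Fin n) (v.adicCompletion K)) i j) ≤ 1}) ∩
        ⋂ i, ⋂ j, {g : GL (Fin n) (v.adicCompletion K) |
          Valued.v (((g⁻¹ : GL (Fin n) (v.adicCompletion K)) :
            Matrix (Fin n) (Fin n) (v.adicCompletion K)) i j) ≤ 1}) ∩
        ⋂ i, ⋂ j, {g : GL (Fin n) (v.adicCompletion K) |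
          Valued.v (((g : Matrix (Fin n) (Fin n) (v.adicCompletion K)) - 1) i j) ≤ c} := by
    ext g
    simp only [SetLike.mem_coe, mem_valuedCongruenceSubgroup_iff, Set.mem_inter_iff,
      Set.mem_iInter, Set.mem_setOf_eq, and_assoc]
  rw [hset]
  exact ((isOpen_iInter_of_finite fun i => isOpen_iInter_of_finite fun j => e1 i j).inter
    (isOpen_iInter_of_finite fun i => isOpen_iInter_of_finite fun j => e2 i j)).inter
    (isOpen_iInter_of_finite fun i => isOpen_iInter_of_finite fun j => e3 i j)

end Local

/-! ### The finite part of the principal congruence subgroup is compact open -/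

section Global

variable (n : ℕ) (K : Type) [Field K] [NumberField K]

variable {n K} in
/-- The `v`-component of `ofFinite h = (1, h)` is the `v`-component of `h`:
`toLocal_v (1, h) = h_v` (entries `(δ_{ij}, h_{ij}) ↦ h_{ij}(v)`). [folklore] -/
theorem toLocal_ofFinite (v : HeightOneSpectrum (𝓞 K)) (h : GL (Fin n) (FiniteAdeleRing (𝓞 K) K)) :
    (AdelicGroupData.gl n K).toLocal v (GLn.ofFinite n K h) =
      Matrix.GeneralLinearGroup.map (AdelicGroupData.finiteAdeleEval K v) h := by
  refine Matrix.GeneralLinearGroup.ext fun i j => ?_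
  change AdelicGroupData.adeleEval K v
      ((GLn.ofFinite n K h : Matrix (Fin n) (Fin n) (NumberField.AdeleRing (𝓞 K) K)) i j) =
    AdelicGroupData.finiteAdeleEval K v ((h : Matrix (Fin n) (Fin n) (FiniteAdeleRing (𝓞 K) K)) i j)
  rw [GLn.coe_ofFinite_apply, AdelicGroupData.adeleEval_apply]
  rfl

/-- **The finite part `K_f(𝔫) = ofFinite⁻¹ K(𝔫) ≤ GL_n(𝔸_K^∞)` of the principal congruence
subgroup of nonzero level `𝔫` is open**: it contains (indeed equals) the open subgroup
`GL_n(𝒪̂_K) ∩ ⋂_{v ∣ 𝔫} {h | h_v ∈ K_v(|𝔫|_v)}` — a finite intersection (`Ideal.finite_factors`) of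
the open `GL_n(𝒪̂_K)` (`isOpen_glFiniteIntegralLevel`) with preimages of the open
`K_v(|𝔫|_v)` (`isOpen_valuedCongruenceSubgroup_of_ne_zero`) under the continuous `h ↦ h_v`; at
`v ∤ 𝔫` the
level condition `h_v ∈ GL_n(𝒪_v)` is implied by integrality
(`toLocal_mem_valuedCongruenceSubgroup_one`).  (Bump, §3.3: the congruence subgroups of
`K_0 = ∏_v GL(n, 𝔬_v)` are open in `GL(n, A_f)`.) [folklore] -/
theorem isOpen_comap_ofFinite_principalCongruenceLevel {𝔫 : Ideal (𝓞 K)} (h𝔫 : 𝔫 ≠ 0) :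
    IsOpen (((principalCongruenceLevel n K 𝔫).comap (GLn.ofFinite n K) :
      Subgroup (GL (Fin n) (FiniteAdeleRing (𝓞 K) K))) :
        Set (GL (Fin n) (FiniteAdeleRing (𝓞 K) K))) := by
  set S : Set (HeightOneSpectrum (𝓞 K)) := {v | v.asIdeal ∣ 𝔫} with hS
  have hSf : S.Finite := Ideal.finite_factors h𝔫
  set H : Subgroup (GL (Fin n) (FiniteAdeleRing (𝓞 K) K)) := glFiniteIntegralLevel n K ⊓
    ⨅ v ∈ S, (valuedCongruenceSubgroup (Fin n) (idealRadius K v 𝔫)).comap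
      (Matrix.GeneralLinearGroup.map (AdelicGroupData.finiteAdeleEval K v)) with hH
  have hle : H ≤ (principalCongruenceLevel n K 𝔫).comap (GLn.ofFinite n K) := by
    intro h hh
    rw [hH, Subgroup.mem_inf, Subgroup.mem_iInf] at hh
    obtain ⟨h1, h2⟩ := hh
    rw [Subgroup.mem_comap, mem_principalCongruenceLevel_iff]
    refine ⟨GLn.ofFinite_mem_glIntegralLevel h1, fun v => ?_⟩
    by_cases hv : v ∈ S
    · have h3 := h2 v
      rw [Subgroup.mem_iInf] at h3
      have h4 := h3 hv
      rw [Subgroup.mem_comap] at h4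
      rwa [toLocal_ofFinite]
    · rw [idealRadius_eq_one_of_not_dvd h𝔫 hv]
      exact toLocal_mem_valuedCongruenceSubgroup_one (GLn.ofFinite_mem_glIntegralLevel h1) v
  refine Subgroup.isOpen_mono hle ?_
  rw [hH, Subgroup.coe_inf, Subgroup.coe_iInf]
  refine (isOpen_glFiniteIntegralLevel n K).inter ?_
  simp only [Subgroup.coe_iInf]
  refine hSf.isOpen_biInter fun v _ => ?_
  rw [Subgroup.coe_comap]
  have hr : idealRadius K v 𝔫 ≠ 0 := by
    unfold idealRadius
    exact WithZero.exp_ne_zero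
  exact (isOpen_valuedCongruenceSubgroup_of_ne_zero K v n hr).preimage
    (AdelicGroupData.continuous_finiteAdeleEval K v).generalLinearGroup_map

/-- `K_f(𝔫) ≤ GL_n(𝒪̂_K)` (the finite part of `K(𝔫) ≤ K^max = {1} × GL_n(𝒪̂_K)`). [folklore] -/
theorem comap_ofFinite_principalCongruenceLevel_le (𝔫 : Ideal (𝓞 K)) :
    (principalCongruenceLevel n K 𝔫).comap (GLn.ofFinite n K) ≤ glFiniteIntegralLevel n K := by
  intro h hh
  have h1 := principalCongruenceLevel_le n K 𝔫 hh
  rw [mem_glIntegralLevel_iff, GLn.sndHom_ofFinite] at h1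
  exact h1.1

/-- **`K_f(𝔫)` is compact** (nonzero `𝔫`): an open, hence closed, subgroup contained in the compact
`GL_n(𝒪̂_K)` (`isCompact_glFiniteIntegralLevel_holds`).  (Bump, §3.3.) [folklore] -/
theorem isCompact_comap_ofFinite_principalCongruenceLevel {𝔫 : Ideal (𝓞 K)} (h𝔫 : 𝔫 ≠ 0) :
    IsCompact (((principalCongruenceLevel n K 𝔫).comap (GLn.ofFinite n K) :
      Subgroup (GL (Fin n) (FiniteAdeleRing (𝓞 K) K))) :
        Set (GL (Fin n) (FiniteAdeleRing (𝓞 K) K))) := by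
  have hc : IsCompact (glFiniteIntegralLevel n K : Set (GL (Fin n) (FiniteAdeleRing (𝓞 K) K))) :=
    isCompact_glFiniteIntegralLevel_holds n K
  exact hc.of_isClosed_subset
    (Subgroup.isClosed_of_isOpen _ (isOpen_comap_ofFinite_principalCongruenceLevel n K h𝔫))
    (comap_ofFinite_principalCongruenceLevel_le n K 𝔫)

/-- **`(GL_n(𝔸_K^∞), K_f(𝔫))` is a Hecke pair** (nonzero `𝔫`): every double coset
`K_f(𝔫) g K_f(𝔫)` is a finite union of single cosets (Mathlib `IsHeckeTriple`), `K_f(𝔫)` being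
compact open (`isHeckeTriple_top_of_isCompact_isOpen`; Shimura, Ch. 3, Prop. 3.1).
[cite: ShimuraIATAF1971, Ch. 3 §3.1 Prop. 3.1] -/
theorem isHeckeTriple_comap_ofFinite_principalCongruenceLevel {𝔫 : Ideal (𝓞 K)} (h𝔫 : 𝔫 ≠ 0) :
    IsHeckeTriple (⊤ : Submonoid (GL (Fin n) (FiniteAdeleRing (𝓞 K) K)))
      ((principalCongruenceLevel n K 𝔫).comap (GLn.ofFinite n K))
      ((principalCongruenceLevel n K 𝔫).comap (GLn.ofFinite n K)) :=
  isHeckeTriple_top_of_isCompact_isOpen _ (isCompact_comap_ofFinite_principalCongruenceLevel n K h𝔫)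
    (isOpen_comap_ofFinite_principalCongruenceLevel n K h𝔫)

end Global

/-! ### The level `K_f(M)` of [Ash2003] and its Hecke operators -/

namespace Ash2003

/-- The level ideal `(M) ⊆ ℤ` is nonzero for `M ≠ 0`. [folklore] -/
theorem span_natCast_ne_zero {M : ℕ} (hM : M ≠ 0) : Ideal.span {(M : 𝓞 ℚ)} ≠ 0 := by
  rw [Ne, Ideal.zero_eq_bot, Ideal.span_singleton_eq_bot]
  exact_mod_cast hM

/-- **`K_f(M) ≤ GL_n(𝔸_ℚ^∞)` is open** (`M ≠ 0`) [Ash2003, §2]. [folklore] -/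
theorem isOpen_finiteLevel (n : ℕ) {M : ℕ} (hM : M ≠ 0) :
    IsOpen (finiteLevel n M : Set (GL (Fin n) (FiniteAdeleRing (𝓞 ℚ) ℚ))) :=
  isOpen_comap_ofFinite_principalCongruenceLevel n ℚ (span_natCast_ne_zero hM)

/-- **`K_f(M) ≤ GL_n(𝔸_ℚ^∞)` is compact** (`M ≠ 0`) [Ash2003, §2]. [folklore] -/
theorem isCompact_finiteLevel (n : ℕ) {M : ℕ} (hM : M ≠ 0) :
    IsCompact (finiteLevel n M : Set (GL (Fin n) (FiniteAdeleRing (𝓞 ℚ) ℚ))) :=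
  isCompact_comap_ofFinite_principalCongruenceLevel n ℚ (span_natCast_ne_zero hM)

/-- **Every double coset `K_f(M) g K_f(M) / K_f(M)` is finite** (`M ≠ 0`, any
`g ∈ GL_n(𝔸_ℚ^∞)`): `K_f(M)` is a compact open subgroup, hence `K_f(M) ∩ g K_f(M) g⁻¹` has finite
index in it ([Ash2003, §2, p. 47]: "`K_l s_l K_l = ∐ s_{i,l} K_l` (finite union)"; Shimura, Ch. 3,
Prop. 3.1).  In particular the Hecke operators `Ash2003.heckeT` of the fact
`Ash2003_inducedRayClassCharacter_attached` never take the junk value of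
`ArithmeticQuotient.heckeFun`. [cite: Ash2003, §2] -/
theorem finite_doubleCosetQuot_finiteLevel (n : ℕ) {M : ℕ} (hM : M ≠ 0)
    (g : GL (Fin n) (FiniteAdeleRing (𝓞 ℚ) ℚ)) :
    (ArithmeticQuotient.doubleCosetQuot (finiteLevel n M) g).Finite := by
  haveI : IsHeckeTriple (⊤ : Submonoid (GL (Fin n) (FiniteAdeleRing (𝓞 ℚ) ℚ))) (finiteLevel n M)
      (finiteLevel n M) :=
    isHeckeTriple_comap_ofFinite_principalCongruenceLevel n ℚ (span_natCast_ne_zero hM)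
  exact finite_orbit_quotient (finiteLevel n M) g

open scoped Classical in
/-- **The Hecke operators of [Ash2003, §2] are honest finite sums**: on the coefficient functions
`Fun(GL_n(𝔸_ℚ^∞) ⧸ K_f(M), V)`, `(T_g f)(c) = ∑_{d ∈ K_f(M) g K_f(M) / K_f(M)} f(c̃ d)` with the finite
index set of `finite_doubleCosetQuot_finiteLevel` (no junk branch). [cite: Ash2003, §2] -/
theorem heckeFun_finiteLevel_apply (n : ℕ) {M : ℕ} (hM : M ≠ 0) (F : Type) [Field F]
    (g : GL (Fin n) (FiniteAdeleRing (𝓞 ℚ) ℚ))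
    (f : (GL (Fin n) (FiniteAdeleRing (𝓞 ℚ) ℚ) ⧸ finiteLevel n M) → F)
    (c : GL (Fin n) (FiniteAdeleRing (𝓞 ℚ) ℚ) ⧸ finiteLevel n M) :
    ArithmeticQuotient.heckeFun F (finiteLevel n M) g F f c =
      ∑ d ∈ (finite_doubleCosetQuot_finiteLevel n hM g).toFinset, f (c.out • d) := by
  rw [ArithmeticQuotient.heckeFun_apply, dif_pos (finite_doubleCosetQuot_finiteLevel n hM g)]

end Ash2003

end Literature.NumberTheory.Automorphic
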